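import Mathlib
import Summits.Ventures.HodgeRepro.Tier4.Line4.RatioFinal
import Summits.Ventures.HodgeRepro.Tier4.Line4.TailGlueRatio

/-!
# Tier4/Line4/RatioBridge — the (F) theorem of record in TailGlue's `hratio` shape: `∃ c₀, ∀ n₁ ≥ c₀ + 1, ∃ C′ > 0, hratio`

Blind re-derivation cell `pub-hodge-repro`, Tier 4 «prove the step» (README §9–§10), seat t4-L1-p4 (gen 5; LINE L4; plan-4 g7's
cut S16135: «write the bridge `hratio_of_ratioFinal` on the tree and hand the consumption to L2-p2 g6»).  Tree path
`lean/Summits/Ventures/HodgeRepro/Tier4/Line4/RatioBridge.lean`.  Imports `Line4/RatioFinal` (this seat, p715385: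
`ratio_display_of_unit_beta_of_proper`) and `Line4/TailGlueRatio` (t4-x2, p711548: `finPart_mat_ofFinPart_le_one_of_natSize`,
the integrality clause in the `natSize k v p < 1` form of the glue).  Mathlib-level; no literature; no `def`.

WHAT.  RatioFinal proves (S-RATIO) at the levels `q^(n + c₀ + 1)`, `c₀` existential (P2's congruence depth).  TailGlueMain /
TailGlueRatio bind `hratio` at `p^(N + n₁)` for a level shift `n₁` of their own, with the transporter clause in front and the
constant positive: `(C′ : ℝ) (hC′ : 0 < C′) (hratio : ∀ N γ, ¬ transporter γ → (suppMeasureFolded (p^(N+n₁)) γ).toReal ≤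
C′ · (suppMeasure (p^(N+n₁)) γ₀).toReal)`.  `exists_hratio_of_ratioFinal` re-indexes: for EVERY `n₁ ≥ c₀ + 1` the triple
exists (`N + n₁ = (N + (n₁ − c₀ − 1)) + c₀ + 1`; `C′ := max C 1`).  The consumer takes its `n₁` at least `c₀ + 1`
(its other level binders — (S-SEP) `hsep : ∀ n ≥ n₁, …`, (S-IDX) — are monotone in `n₁`).  The integrality clause is taken
in TailGlueRatio's `natSize` form and transported by its own `finPart_mat_ofFinPart_le_one_of_natSize`.

Nothing here says anything about the status of the Hodge conjecture for CM abelian varieties, which is NOT proved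
(HC_CM is NOT proved by anyone in this repository).
-/

set_option autoImplicit false
noncomputable section
namespace Summit.Ventures.HodgeRepro.Tier4.Line4
open Summit.Ventures.HodgeRepro.Tier4 Summit.Ventures.HodgeRepro.Tier4.Common
  Summit.Ventures.HodgeRepro.Tier4.Line1 MeasureTheory IsDedekindDomain NumberField Matrix
open scoped ENNReal NNReal Pointwise

section Bridge
variable {k : Type} [Field k] [NumberField k] (W : PlaneData k) [MeasurableSpace (GA W)] [BorelSpace (GA W)]
  (R : RTFData W)

/-- **THE (F) THEOREM OF RECORD IN TailGlue's `hratio` SHAPE**: there is `c₀` such that for every level shift `n₁ ≥ c₀ + 1`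
there is `C′ > 0` with `hratio` at `p^(N + n₁)` (the transporter clause idle: proved for every rational `γ`).  Binders =
RatioFinal's `ratio_display_of_unit_beta_of_proper` with the integrality clause in TailGlueRatio's `natSize` form. -/
theorem exists_hratio_of_ratioFinal {d : k}
    (hΩ : W.Ω * W.Ω = -(d • (1 : Matrix (Fin 4) (Fin 4) k)))
    (hd : ¬ IsSquare (-d)) (hΩB : W.Ω * W.B = -(W.B * W.Ωᵀ)) (hPB : ∀ i, W.P i * W.B = W.B * (W.P i)ᵀ)
    (hQB : ∀ j, W.Q j * W.B = W.B * (W.Q j)ᵀ) (hPr : ∀ i, (W.P i).rank = 2) (hQr : ∀ j, (W.Q j).rank = 2)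
    (hB : W.B.det ≠ 0) (hg : IsGenuineRow W) (γ₀ : rationalPoints W) (hreg : IsLinRegular W γ₀) (p : ℕ) (hp : p.Prime)
    (hγ₀ : ∀ v : HeightOneSpectrum (𝓞 k), natSize k v p < 1 → ∀ i j : Fin 4,
      Valued.v (finPart k (GA.mat W (γ₀ : GA W) i j) v) ≤ 1 ∧ Valued.v (finPart k (GA.mat W (γ₀ : GA W)⁻¹ i j) v) ≤ 1)
    (hR : R.IsHaar) (compT : IsCompact (closure R.DT)) (compT' : IsCompact (closure R.DT'))
    (νinf : Measure (torusInf W)) [νinf.IsHaarMeasure] [IsFiniteMeasure νinf]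
    (νf : Measure (torusFin W)) [νf.IsHaarMeasure]
    (c : ℝ≥0) (hc : R.μT = c • Measure.map (torusSplit W).symm (νinf.prod νf))
    (νinf' : Measure (torusInf' W)) [νinf'.IsHaarMeasure] [IsFiniteMeasure νinf']
    (νf' : Measure (torusFin' W)) [νf'.IsHaarMeasure]
    (c' : ℝ≥0) (hc' : R.μT' = c' • Measure.map (torusSplit' W).symm (νinf'.prod νf'))
    (νS : Measure (torusFinAt W (placesAbove (k := k) p))) [νS.IsHaarMeasure]
    (νA : Measure (torusFinAway W (placesAbove (k := k) p))) [νA.IsHaarMeasure]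
    (cq : ℝ≥0) (hcq : νf = cq • Measure.map (torusFinSplit W (placesAbove (k := k) p)).symm (νS.prod νA))
    (DZf : Set (torusFin W)) (hDZf : MeasurableSet DZf) (hfd : IsFundamentalDomain (centreFin W) DZf νf)
    (hDZc : ∀ C : Set (torusFin W), IsCompact C → IsCompact (closure (DZf ∩ (C * (ZfIn W : Set (torusFin W))))))
    (hZ : CentreFinFinite W) :
    ∃ c₀ : ℕ, ∀ n₁ : ℕ, c₀ + 1 ≤ n₁ → ∃ C' : ℝ, 0 < C' ∧ ∀ (N : ℕ) (γ : rationalPoints W),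
      ¬ ((torusT W).map (MulAut.conj ((γ : GA W))⁻¹).toMonoidHom = torusT' W) →
      (suppMeasureFolded W R (γ₀ : GA W) (p ^ (N + n₁)) (γ : GA W)).toReal ≤
        C' * (suppMeasure W νf νf' (γ₀ : GA W) DZf (p ^ (N + n₁)) (γ₀ : GA W)).toReal := by
  obtain ⟨h1, h2⟩ := finPart_mat_ofFinPart_le_one_of_natSize W (γ₀ : GA W) p hγ₀
  obtain ⟨c₀, C, hC⟩ := ratio_display_of_unit_beta_of_proper W R hΩ hd hΩB hPB hQB hPr hQr hB hg γ₀ hreg p hp h1 h2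
    hR compT compT' νinf νf c hc νinf' νf' c' hc' νS νA cq hcq DZf hDZf hfd hDZc hZ
  refine ⟨c₀, fun n₁ hn₁ => ⟨max C 1, lt_of_lt_of_le one_pos (le_max_right _ _), fun N γ _ => ?_⟩⟩
  have h := hC (N + (n₁ - c₀ - 1)) γ
  rw [show N + (n₁ - c₀ - 1) + c₀ + 1 = N + n₁ by omega] at h
  exact h.trans (mul_le_mul_of_nonneg_right (le_max_left _ _) ENNReal.toReal_nonneg)

end Bridge

end Summit.Ventures.HodgeRepro.Tier4.Line4

end
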